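import Summits.CriticalPhenomena.PercolationContinuityZ3.Theorems.PercNearOneGluingNoHeavyLowerTailSunflowerPrincipalPetal
import Mathlib.Combinatorics.Hall.Basic
import HarnessLib
import HarnessLib.Audit

/-!
# `NoHeavyLowerTail` (crux stmt-CriticalPhenomena-4575), abstract sunflower cubic: the HALL–GLADKOV MATCHING form of the two-copy
# conjecture `IX-gen`, the equivalence of the two forms (Hall's marriage theorem), and the consequence
# `IX-gen ⇒ ★ for every sunflower with an INTERSECTING petal`

Support file (seat `prim-l12-p2` gen 15; `--supports stmt-CriticalPhenomena-4575`).  Nothing is asserted about the crux; no `sorry`; the two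
`@[conjecture]` definitions are obligations of this programme (census-true, unproved), never facts — they are used only as explicit hypotheses.
Memo: run/shared/lean/prim/prim-l12/prim-l12-p2/FINDING-g15-HALL-GLADKOV.md.

BACKGROUND.  Gens 13–14 reduced "Lemma B (`Ntri ≤ 3·SB`), hence ★ (`PartitionLemmaH`), for every sunflower having an INTERSECTING petal" to a
two-copy (antipodal) inequality `IX-gen` about THREE arbitrary up-sets `𝒮, U₂, U₃` of a cube (`Ψ = H(𝒮) + G₀(pairs avoiding 𝒮) ≥ 0`), proved it
for centred/principal `𝒮` (`Sunflower.cube_le`, `…PrincipalCube`), and showed that no one-coordinate induction certifies it ("hard cores").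

THIS FILE.
* `Ψ` is AFFINE in the up-set `U₂`; minimising over `U₂` is a closure (min-cut) problem whose LP dual is a bipartite matching.  Hence the
  COUNTING FORM `IXGen` — for up-sets `V₁, V₂`, a down-set `D` and a cube `W`:
    `#{T ∈ D ∩ POS} ≤ #{O ∈ D ∩ NEG}`,  where (complements taken inside `W`)
    `POS = {T ∈ V₁∖V₂ : W∖T ∉ V₁} ∪ {T ∈ V₂∖V₁ : W∖T ∉ V₁ ∪ V₂}`,  `NEG = {O ∉ V₁ ∪ V₂ : W∖O ∈ V₁ ∪ V₂}`
  (with `(V₁,V₂,Dᶜ) = (𝒮,U₃,U₂)` this is literally `Ψ = #(NEG∖U₂) − #(POS∖U₂) ≥ 0`) — is EQUIVALENT to the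
  MATCHING FORM `HallGladkov`: `POS` admits an injection `φ` into `NEG` with `φ T ⊆ T` ("every petal-side set of the listed antipodal pair types
  can be pushed down to a distinct bottom set whose complement is not bottom").  `|NEG| − |POS|` is exactly Gladkov's two-petal surplus
  `#{kernel|bottom} − #{petal₁|petal₂}` of the pair `(V₁,V₂)`, so `HallGladkov` is a "marriage version" of Gladkov's strong Harris inequality.
  `ixGen_of_hallGladkov` (an injection below `T` stays inside every down-set containing `T`) and `hallGladkov_of_ixGen` (Hall's condition for a
  subfamily `𝒟 ⊆ POS` is `IXGen` at the down-set `↓𝒟`; Mathlib's `Finset.all_card_le_biUnion_card_iff_exists_injective`).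
* `Sunflower.cube_le_of_ixGen`: `IXGen` (at `V₁ = ↑C₀` the up-closure of petal `0`, `V₂ = V 2`, `D = (V 1)ᶜ`) gives, for a sunflower whose petal
  `0` is an INTERSECTING family, the cube inequality of `…PrincipalCube` on every cube: `#{(1,⊤)} + #{(⊤,1)} ≤ Σ kk` — hence
  `two_N140_le_SB_of_ixGen`, Lemma B `Ntri_le_three_SB_of_ixGen` and **★ `ZH_nonneg_of_ixGen_of_intersecting`** (any petal, via `rotate`):
  the partition lemma for every sunflower with an intersecting petal, CONDITIONAL on `IXGen` (equivalently on `HallGladkov`).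
Census (memo; code/t12.c): matching exists for all 28 224 pairs on 4 points, 4·10⁵ random pairs on 5–6 points; `IXGen` exhaustive on ≤ 4 points.
-/

namespace Summit.CriticalPhenomena.PercolationContinuityZ3.Theorems.SunflowerPartition

open Finset

/-! ## The two-up-set families `POS`, `NEG` and the two typed conjectures -/

namespace HallGladkov

variable {α : Type*} [DecidableEq α]

/-- `POS`: inside the cube `W`, the sets `T ∈ V₁ ∖ V₂` with `W ∖ T ∉ V₁`, and the sets `T ∈ V₂ ∖ V₁` with `W ∖ T ∉ V₁ ∪ V₂`. [this work] -/
def pos (V₁ V₂ : Finset (Finset α)) (W : Finset α) : Finset (Finset α) :=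
  W.powerset.filter fun T => (T ∈ V₁ ∧ T ∉ V₂ ∧ W \ T ∉ V₁) ∨ (T ∈ V₂ ∧ T ∉ V₁ ∧ W \ T ∉ V₁ ∧ W \ T ∉ V₂)

/-- `NEG`: inside the cube `W`, the sets outside `V₁ ∪ V₂` whose complement in `W` lies in `V₁ ∪ V₂`. [this work] -/
def neg (V₁ V₂ : Finset (Finset α)) (W : Finset α) : Finset (Finset α) :=
  W.powerset.filter fun O => O ∉ V₁ ∧ O ∉ V₂ ∧ (W \ O ∈ V₁ ∨ W \ O ∈ V₂)

omit [DecidableEq α] in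
/-- The down-closure of a finite family of finite sets is a down-set. [folklore] -/
theorem isLowerSet_biUnion_powerset [DecidableEq α] (s : Finset (Finset α)) :
    IsLowerSet ((s.biUnion fun T => T.powerset : Finset (Finset α)) : Set (Finset α)) := by
  intro A B hBA hA
  rw [Finset.mem_coe, mem_biUnion] at hA ⊢
  obtain ⟨T, hT, hAT⟩ := hA
  exact ⟨T, hT, mem_powerset.2 (subset_trans hBA (mem_powerset.1 hAT))⟩

end HallGladkov

/-- **`IX-gen`, counting form** (this work; OPEN, census-clean: all triples of up-sets on ≤ 4 points, 3·10⁵ random on 5–6 points; it is the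
lane's two-copy conjecture `IX-gen` of gens 13–14 with `(V₁,V₂,Dᶜ) = (𝒮,U₃,U₂)`): for up-sets `V₁, V₂`, a down-set `D` and a cube `W`,
the `D`-part of `POS` is not larger than the `D`-part of `NEG`.  An obligation, never a fact: use as `(h : IXGen)`. [status: open] -/
@[conjecture] def IXGen : Prop :=
  ∀ (α : Type) [DecidableEq α] (V₁ V₂ D : Finset (Finset α)) (W : Finset α),
    IsUpperSet (V₁ : Set (Finset α)) → IsUpperSet (V₂ : Set (Finset α)) → IsLowerSet (D : Set (Finset α)) →
      ((HallGladkov.pos V₁ V₂ W).filter (· ∈ D)).card ≤ ((HallGladkov.neg V₁ V₂ W).filter (· ∈ D)).card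

/-- **HALL–GLADKOV, matching form** (this work; OPEN, equivalent to `IXGen`): for up-sets `V₁, V₂` and a cube `W`, the family `POS` admits
an injection `φ` into `NEG` with `φ T ⊆ T`.  An obligation, never a fact: use as `(h : HallGladkov)`. [status: open] -/
@[conjecture] def HallGladkov : Prop :=
  ∀ (α : Type) [DecidableEq α] (V₁ V₂ : Finset (Finset α)) (W : Finset α),
    IsUpperSet (V₁ : Set (Finset α)) → IsUpperSet (V₂ : Set (Finset α)) →
      ∃ φ : Finset α → Finset α, Set.InjOn φ (HallGladkov.pos V₁ V₂ W : Set (Finset α)) ∧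
        ∀ T ∈ HallGladkov.pos V₁ V₂ W, φ T ∈ HallGladkov.neg V₁ V₂ W ∧ φ T ⊆ T

/-! ## The two forms are equivalent -/

/-- Matching ⇒ counting: an injection below `T` stays inside every down-set containing `T`. [this work] -/
theorem ixGen_of_hallGladkov (h : HallGladkov) : IXGen := by
  intro α _ V₁ V₂ D W h₁ h₂ hD
  obtain ⟨φ, hinj, hφ⟩ := h α V₁ V₂ W h₁ h₂
  refine Finset.card_le_card_of_injOn φ ?_ ?_
  · intro T hT
    rw [Finset.mem_coe, mem_filter] at hT
    rw [Finset.mem_coe, mem_filter]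
    exact ⟨(hφ T hT.1).1, hD (hφ T hT.1).2 hT.2⟩
  · exact hinj.mono (fun T hT => (mem_filter.1 (Finset.mem_coe.1 hT)).1)

/-- Counting ⇒ matching: Hall's condition for `𝒟 ⊆ POS` is `IXGen` at the down-set `↓𝒟`. [this work] -/
theorem hallGladkov_of_ixGen (h : IXGen) : HallGladkov := by
  intro α _ V₁ V₂ W h₁ h₂
  classical
  set P := HallGladkov.pos V₁ V₂ W with hP
  set N := HallGladkov.neg V₁ V₂ W with hN
  -- Hall's condition for the family `t T = {O ∈ NEG : O ⊆ T}` indexed by `T ∈ POS`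
  have hall : ∀ s : Finset P, s.card ≤ (s.biUnion fun T => N.filter (· ⊆ (T.1 : Finset α))).card := by
    intro s
    let D : Finset (Finset α) := (s.image Subtype.val).biUnion fun T => T.powerset
    have hD : IsLowerSet (D : Set (Finset α)) := HallGladkov.isLowerSet_biUnion_powerset _
    have key := h α V₁ V₂ D W h₁ h₂ hD
    have h1 : s.card ≤ (P.filter (· ∈ D)).card := by
      rw [← Finset.card_image_of_injective s Subtype.val_injective]
      refine card_le_card fun T hT => ?_
      obtain ⟨x, hx, rfl⟩ := mem_image.1 hT
      exact mem_filter.2 ⟨x.2, mem_biUnion.2 ⟨x.1, mem_image.2 ⟨x, hx, rfl⟩, mem_powerset.2 subset_rfl⟩⟩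
    have h2 : N.filter (· ∈ D) = s.biUnion fun T => N.filter (· ⊆ (T.1 : Finset α)) := by
      ext O
      constructor
      · intro hO
        obtain ⟨hON, hOD⟩ := mem_filter.1 hO
        obtain ⟨T, hT, hOT⟩ := mem_biUnion.1 hOD
        obtain ⟨x, hx, rfl⟩ := mem_image.1 hT
        exact mem_biUnion.2 ⟨x, hx, mem_filter.2 ⟨hON, mem_powerset.1 hOT⟩⟩
      · intro hO
        obtain ⟨x, hx, hOx⟩ := mem_biUnion.1 hO
        exact mem_filter.2 ⟨(mem_filter.1 hOx).1, mem_biUnion.2 ⟨x.1, mem_image.2 ⟨x, hx, rfl⟩, mem_powerset.2 (mem_filter.1 hOx).2⟩⟩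
    rw [← h2]
    exact le_trans h1 key
  obtain ⟨f, hf, hf2⟩ := (Finset.all_card_le_biUnion_card_iff_exists_injective _).1 hall
  refine ⟨fun T => if hT : T ∈ P then f ⟨T, hT⟩ else ∅, ?_, ?_⟩
  · intro T hT T' hT' hTT'
    have hTP : T ∈ P := hT
    have hTP' : T' ∈ P := hT'
    have e : f ⟨T, hTP⟩ = f ⟨T', hTP'⟩ := by simpa only [dif_pos hTP, dif_pos hTP'] using hTT'
    exact congrArg Subtype.val (hf e)
  · intro T hT
    have hTP : T ∈ P := hT
    simp only [dif_pos hTP]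
    exact mem_filter.1 (hf2 ⟨T, hTP⟩)

/-! ## Consequence: the cube inequality, Lemma B and ★ for a sunflower with an intersecting petal -/

/-- Pointwise kernel inequality behind `cube_le_of_ixGen` (`Pk`/`Nk` = lower/upper label indicators of `D ∩ POS`/`D ∩ NEG`, `gk` an
antisymmetrising correction). [this work] -/
def Pk (x y : Fin 5) : ℤ := if x = 1 ∨ (x = 3 ∧ (y = 0 ∨ y = 2)) then 1 else 0

/-- Upper label indicator of `D ∩ NEG`. [this work] -/
def Nk (x y : Fin 5) : ℤ := if x = 0 ∧ (y = 1 ∨ y = 3 ∨ y = 4) then 1 else 0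

/-- Antisymmetrising correction. [this work] -/
def gk (x y : Fin 5) : ℤ := if (x = 2 ∧ y = 1) ∨ (x = 3 ∧ y = 1) ∨ (x = 2 ∧ y = 3) ∨ (x = 4 ∧ y = 0) then 1 else 0

/-- The pointwise inequality: `2·ind14 − kk ≤ 2·(Pk − Nkᵀ) + (gk − gkᵀ)`. [this work] -/
theorem two_ind14_sub_kk_le : ∀ x y : Fin 5, 2 * ind14 x y - kk x y ≤ 2 * (Pk x y - Nk y x) + (gk x y - gk y x) := by decide

namespace Sunflower

variable {α : Type*} [Fintype α] [DecidableEq α] (F : Sunflower α)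

/-- The up-closure `↑C₀` of petal `0`: sets containing a petal-`0` set. [this work] -/
def petalUp : Finset (Finset α) := univ.filter fun T => ∃ S ∈ T.powerset, F.lab S = 1

/-- Membership in `petalUp`. [this work] -/
theorem mem_petalUp {T : Finset α} : T ∈ F.petalUp ↔ ∃ S, S ⊆ T ∧ F.lab S = 1 := by
  unfold petalUp
  simp only [mem_filter, mem_univ, true_and, mem_powerset]

/-- `petalUp` is an up-set. [this work] -/
theorem petalUp_upper : IsUpperSet (F.petalUp : Set (Finset α)) := by
  intro A B hAB hA
  rw [Finset.mem_coe, mem_petalUp] at hA ⊢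
  obtain ⟨S, hS, h1⟩ := hA
  exact ⟨S, subset_trans hS hAB, h1⟩

/-- A set above a petal-`0` set has label `1` or `⊤`. [this work] -/
theorem lab_of_mem_petalUp {T : Finset α} (hT : T ∈ F.petalUp) : F.lab T = 1 ∨ F.lab T = 4 := by
  rw [mem_petalUp] at hT
  obtain ⟨S, hS, h1⟩ := hT
  have hS0 : S ∈ F.V 0 := (F.lab_V0_iff S).1 (Or.inl h1)
  exact (F.lab_V0_iff T).2 (F.upper 0 hS hS0)

omit [Fintype α] in
/-- `V i` is an up-set (coercion form). [this work] -/
theorem V_upper (i : Fin 3) : IsUpperSet (F.V i : Set (Finset α)) := F.upper i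

omit [Fintype α] in
/-- Swapping `T ↔ W ∖ T` in an antipodal sum over a cube. [folklore] -/
theorem sum_powerset_antipodal_swap (W : Finset α) (f : Fin 5 → Fin 5 → ℤ) :
    ∑ T ∈ W.powerset, f (F.lab T) (F.lab (W \ T)) = ∑ T ∈ W.powerset, f (F.lab (W \ T)) (F.lab T) := by
  refine sum_bij' (fun S _ => W \ S) (fun S _ => W \ S) ?_ ?_ ?_ ?_ ?_
  · intro S _; exact mem_powerset.2 sdiff_subset
  · intro S _; exact mem_powerset.2 sdiff_subset
  · intro S hS; exact Finset.sdiff_sdiff_eq_self (mem_powerset.1 hS)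
  · intro S hS; exact Finset.sdiff_sdiff_eq_self (mem_powerset.1 hS)
  · intro S hS
    rw [Finset.sdiff_sdiff_eq_self (mem_powerset.1 hS)]

end Sunflower

/-! ### The conditional theorems (ground types in `Type`, as in `IXGen`) -/

section Conditional

variable {α : Type} [Fintype α] [DecidableEq α]

/-- Lower label indicator of `D ∩ POS` (pointwise): for `T ⊆ W` with labels `(x,y) = (lab T, lab (W∖T))`, `Pk x y ≤ [T ∈ D ∩ POS]` when petal `0`
is intersecting (`V₁ = ↑C₀`, `V₂ = V 2`, `D = (V 1)ᶜ`). [this work] -/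
theorem Sunflower.Pk_le (F : Sunflower α) (hI : ∀ S T : Finset α, F.lab S = 1 → F.lab T = 1 → ¬ Disjoint S T)
    (W T : Finset α) (hT : T ∈ W.powerset) :
    Pk (F.lab T) (F.lab (W \ T)) ≤
      if T ∈ (HallGladkov.pos F.petalUp (F.V 2) W).filter (· ∈ (univ.filter fun T => T ∉ F.V 1)) then 1 else 0 := by
  by_cases hmem : T ∈ (HallGladkov.pos F.petalUp (F.V 2) W).filter (· ∈ (univ.filter fun T => T ∉ F.V 1))
  · rw [if_pos hmem]; unfold Pk; split_ifs <;> norm_num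
  · rw [if_neg hmem]
    unfold Pk
    rw [if_neg]
    intro hc
    apply hmem
    rw [mem_filter, mem_filter]
    simp only [mem_univ, true_and]
    unfold HallGladkov.pos
    rw [mem_filter]
    have hV1T : T ∉ F.V 1 := fun hmem1 => by
      have := (F.lab_V1_iff T).2 hmem1
      rcases hc with h1 | ⟨h3, _⟩ <;> omega
    refine ⟨⟨hT, ?_⟩, hV1T⟩
    rcases hc with h1 | ⟨h3, hy⟩
    · -- `lab T = 1`: first kind
      left
      refine ⟨F.mem_petalUp.2 ⟨T, subset_rfl, h1⟩, fun h2 => ?_, fun hup => ?_⟩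
      · have := (F.lab_V2_iff T).2 h2; omega
      · obtain ⟨S, hS, hS1⟩ := F.mem_petalUp.1 hup
        exact hI S T hS1 h1 (Disjoint.mono_left hS sdiff_disjoint)
    · -- `lab T = 3`, `lab (W∖T) ∈ {0,2}`: second kind
      right
      refine ⟨(F.lab_V2_iff T).1 (Or.inl h3), fun hup => ?_, fun hup => ?_, fun h2 => ?_⟩
      · have := F.lab_of_mem_petalUp hup; omega
      · have := F.lab_of_mem_petalUp hup; omega
      · have := (F.lab_V2_iff (W \ T)).2 h2; omega

/-- Upper label indicator of `D ∩ NEG` (pointwise). [this work] -/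
theorem Sunflower.le_Nk (F : Sunflower α) (W T : Finset α) :
    (if T ∈ (HallGladkov.neg F.petalUp (F.V 2) W).filter (· ∈ (univ.filter fun T => T ∉ F.V 1)) then (1 : ℤ) else 0)
      ≤ Nk (F.lab T) (F.lab (W \ T)) := by
  by_cases hmem : T ∈ (HallGladkov.neg F.petalUp (F.V 2) W).filter (· ∈ (univ.filter fun T => T ∉ F.V 1))
  · rw [if_pos hmem]
    unfold Nk
    rw [if_pos]
    rw [mem_filter, mem_filter] at hmem
    simp only [mem_univ, true_and] at hmem
    obtain ⟨hneg, hV1T⟩ := hmem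
    unfold HallGladkov.neg at hneg
    rw [mem_filter] at hneg
    obtain ⟨_, hup, hV2T, hcomp⟩ := hneg
    have hx1 : F.lab T ≠ 1 := fun h1 => hup (F.mem_petalUp.2 ⟨T, subset_rfl, h1⟩)
    have hx24 : ¬ (F.lab T = 2 ∨ F.lab T = 4) := fun h => hV1T ((F.lab_V1_iff T).1 h)
    have hx34 : ¬ (F.lab T = 3 ∨ F.lab T = 4) := fun h => hV2T ((F.lab_V2_iff T).1 h)
    refine ⟨by omega, ?_⟩
    rcases hcomp with hc | hc
    · have := F.lab_of_mem_petalUp hc; omega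
    · have := (F.lab_V2_iff (W \ T)).2 hc; omega
  · rw [if_neg hmem]; unfold Nk; split_ifs <;> norm_num

/-- **The cube inequality from `IXGen`** for a sunflower whose petal `0` is an intersecting family: on every cube `W`, the `(1,⊤)` and `(⊤,1)`
antipodal pairs are paid by the Gladkov surplus, `#{(1,⊤)} + #{(⊤,1)} ≤ Σ_{T ⊆ W} kk (lab T) (lab (W∖T))`.  (`IXGen` is applied to
`V₁ = ↑C₀`, `V₂ = V 2`, `D = (V 1)ᶜ`; for an intersecting petal every kernel complement of a petal-`0` set is unforced.) [this work] -/
theorem Sunflower.cube_le_of_ixGen (h : IXGen) (F : Sunflower α)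
    (hI : ∀ S T : Finset α, F.lab S = 1 → F.lab T = 1 → ¬ Disjoint S T) (W : Finset α) :
    ∑ T ∈ W.powerset, (ind14 (F.lab T) (F.lab (W \ T)) + ind14 (F.lab (W \ T)) (F.lab T))
      ≤ ∑ T ∈ W.powerset, kk (F.lab T) (F.lab (W \ T)) := by
  classical
  set D : Finset (Finset α) := univ.filter fun T => T ∉ F.V 1 with hDdef
  have hD : IsLowerSet (D : Set (Finset α)) := by
    intro A B hBA hA
    rw [Finset.mem_coe] at hA ⊢
    rw [hDdef, mem_filter] at hA ⊢
    exact ⟨mem_univ _, fun hB => hA.2 (F.upper 1 hBA hB)⟩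
  have key := h α F.petalUp (F.V 2) D W F.petalUp_upper (F.V_upper 2) hD
  set PD := (HallGladkov.pos F.petalUp (F.V 2) W).filter (· ∈ D) with hPD
  set ND := (HallGladkov.neg F.petalUp (F.V 2) W).filter (· ∈ D) with hND
  have hPsub : PD ⊆ W.powerset := fun T hT => by
    rw [hPD, mem_filter] at hT; unfold HallGladkov.pos at hT; exact (mem_filter.1 hT.1).1
  have hNsub : ND ⊆ W.powerset := fun T hT => by
    rw [hND, mem_filter] at hT; unfold HallGladkov.neg at hT; exact (mem_filter.1 hT.1).1
  -- cardinalities as sums of indicators over the cube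
  have hPcard : (PD.card : ℤ) = ∑ T ∈ W.powerset, (if T ∈ PD then (1 : ℤ) else 0) := by
    rw [Finset.sum_boole, Finset.filter_mem_eq_inter, inter_eq_right.2 hPsub]
  have hNcard : (ND.card : ℤ) = ∑ T ∈ W.powerset, (if T ∈ ND then (1 : ℤ) else 0) := by
    rw [Finset.sum_boole, Finset.filter_mem_eq_inter, inter_eq_right.2 hNsub]
  have hP : ∑ T ∈ W.powerset, Pk (F.lab T) (F.lab (W \ T)) ≤ (PD.card : ℤ) := by
    rw [hPcard]
    exact sum_le_sum fun T hT => F.Pk_le hI W T hT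
  have hN : (ND.card : ℤ) ≤ ∑ T ∈ W.powerset, Nk (F.lab T) (F.lab (W \ T)) := by
    rw [hNcard]
    exact sum_le_sum fun T _ => F.le_Nk W T
  have hkey : (PD.card : ℤ) ≤ (ND.card : ℤ) := by exact_mod_cast key
  -- symmetrisations
  have hNs := F.sum_powerset_antipodal_swap W Nk
  have hgs := F.sum_powerset_antipodal_swap W gk
  have his := F.sum_powerset_antipodal_swap W ind14
  -- the pointwise inequality, summed
  have hpt : ∑ T ∈ W.powerset, (2 * ind14 (F.lab T) (F.lab (W \ T)) - kk (F.lab T) (F.lab (W \ T)))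
      ≤ ∑ T ∈ W.powerset, (2 * (Pk (F.lab T) (F.lab (W \ T)) - Nk (F.lab (W \ T)) (F.lab T))
          + (gk (F.lab T) (F.lab (W \ T)) - gk (F.lab (W \ T)) (F.lab T))) :=
    sum_le_sum fun T _ => two_ind14_sub_kk_le _ _
  rw [sum_sub_distrib, ← mul_sum, sum_add_distrib, sum_sub_distrib, ← mul_sum, sum_sub_distrib] at hpt
  rw [sum_add_distrib]
  linarith

/-- **`2·N140 ≤ SB` from `IXGen`** for a sunflower whose petal `0` is intersecting: block rotation `N140 = N014 = N041` and the cube inequality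
in the complement of every bottom spectator (the proof of `two_N140_le_SB` with `cube_le_of_ixGen` in place of `cube_le`). [this work] -/
theorem Sunflower.two_N140_le_SB_of_ixGen (h : IXGen) (F : Sunflower α)
    (hI : ∀ S T : Finset α, F.lab S = 1 → F.lab T = 1 → ¬ Disjoint S T) : 2 * F.N140 ≤ F.SB := by
  have e014 : F.N140 = ∑ q ∈ parts α, (if F.lab q.1 = 0 then (1 : ℤ) else 0) * ind14 (F.lab q.2) (F.lab (q.1 ∪ q.2)ᶜ) := by
    rw [sum_parts_cyc (α := α) (fun a b c => (if F.lab a = 0 then (1 : ℤ) else 0) * ind14 (F.lab b) (F.lab c))]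
    unfold Sunflower.N140 ind14
    refine sum_congr rfl fun q _ => ?_
    split_ifs <;> simp_all
  have e041 : F.N140 = ∑ q ∈ parts α, (if F.lab q.1 = 0 then (1 : ℤ) else 0) * ind14 (F.lab (q.1 ∪ q.2)ᶜ) (F.lab q.2) := by
    rw [sum_parts_swap13 (α := α) (fun a b c => (if F.lab a = 0 then (1 : ℤ) else 0) * ind14 (F.lab c) (F.lab b))]
    unfold Sunflower.N140 ind14
    refine sum_congr rfl fun q _ => ?_
    split_ifs <;> simp_all
  have hsum : 2 * F.N140 = ∑ q ∈ parts α, (if F.lab q.1 = 0 then (1 : ℤ) else 0) *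
      (ind14 (F.lab q.2) (F.lab (q.1 ∪ q.2)ᶜ) + ind14 (F.lab (q.1 ∪ q.2)ᶜ) (F.lab q.2)) := by
    have hs : (∑ q ∈ parts α, (if F.lab q.1 = 0 then (1 : ℤ) else 0) *
        (ind14 (F.lab q.2) (F.lab (q.1 ∪ q.2)ᶜ) + ind14 (F.lab (q.1 ∪ q.2)ᶜ) (F.lab q.2)))
        = (∑ q ∈ parts α, (if F.lab q.1 = 0 then (1 : ℤ) else 0) * ind14 (F.lab q.2) (F.lab (q.1 ∪ q.2)ᶜ))
          + ∑ q ∈ parts α, (if F.lab q.1 = 0 then (1 : ℤ) else 0) * ind14 (F.lab (q.1 ∪ q.2)ᶜ) (F.lab q.2) := by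
      rw [← sum_add_distrib]
      exact sum_congr rfl fun q _ => by ring
    rw [hs, ← e014, ← e041]
    ring
  rw [hsum]
  unfold Sunflower.SB Sunflower.Sw
  rw [sum_parts_eq (f := fun S T => (if F.lab S = 0 then (1 : ℤ) else 0) * (ind14 (F.lab T) (F.lab (S ∪ T)ᶜ) + ind14 (F.lab (S ∪ T)ᶜ) (F.lab T))),
    sum_parts_eq (f := fun S T => (if F.lab S = 0 then (1 : ℤ) else 0) * kk (F.lab T) (F.lab (S ∪ T)ᶜ))]
  refine sum_le_sum fun S _ => ?_
  rw [← mul_sum, ← mul_sum]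
  by_cases hS : F.lab S = 0
  · rw [if_pos hS, one_mul, one_mul]
    have hc := F.cube_le_of_ixGen h hI Sᶜ
    have hl : ∑ T ∈ Sᶜ.powerset, (ind14 (F.lab T) (F.lab (S ∪ T)ᶜ) + ind14 (F.lab (S ∪ T)ᶜ) (F.lab T))
        = ∑ T ∈ Sᶜ.powerset, (ind14 (F.lab T) (F.lab (Sᶜ \ T)) + ind14 (F.lab (Sᶜ \ T)) (F.lab T)) :=
      sum_congr rfl fun T _ => by rw [compl_union, sdiff_eq_inter_compl]
    have hr : ∑ T ∈ Sᶜ.powerset, kk (F.lab T) (F.lab (S ∪ T)ᶜ) = ∑ T ∈ Sᶜ.powerset, kk (F.lab T) (F.lab (Sᶜ \ T)) :=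
      sum_congr rfl fun T _ => by rw [compl_union, sdiff_eq_inter_compl]
    rw [hl, hr]
    exact hc
  · rw [if_neg hS, zero_mul, zero_mul]

/-- **LEMMA B from `IXGen`** for a sunflower whose petal `0` is an intersecting family: `Ntri ≤ 3·SB`. [this work] -/
theorem Sunflower.Ntri_le_three_SB_of_ixGen (h : IXGen) (F : Sunflower α)
    (hI : ∀ S T : Finset α, F.lab S = 1 → F.lab T = 1 → ¬ Disjoint S T) : F.Ntri ≤ 3 * F.SB := by
  have h1 := F.N123_le_N140
  have h2 := F.two_N140_le_SB_of_ixGen h hI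
  have h3 := F.Ntri_eq_six_mul_N123
  linarith

/-- **★ from `IXGen` for a sunflower whose petal `0` is an intersecting family**: `0 ≤ ZH`. [this work] -/
theorem Sunflower.ZH_nonneg_of_ixGen (h : IXGen) (F : Sunflower α)
    (hI : ∀ S T : Finset α, F.lab S = 1 → F.lab T = 1 → ¬ Disjoint S T) : 0 ≤ F.ZH := by
  rw [F.ZH_eq_SA_SB]
  have h1 := F.Ntri_le_three_SB_of_ixGen h hI
  have h2 := F.SA_nonneg
  linarith

omit [Fintype α] in
/-- The intersecting-petal hypothesis transported along `rotate` (petal `1` of `F` is petal `0` of `F.rotate`). [this work] -/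
theorem Sunflower.rotate_lab_eq_one_iff (F : Sunflower α) (S : Finset α) : F.rotate.lab S = 1 ↔ F.lab S = 2 := by
  rw [F.lab_rotate]
  generalize F.lab S = x
  revert x; decide

/-- **★ from `IXGen` for a sunflower with ANY intersecting petal** (petal `i` intersecting = no two disjoint sets of label `i+1`): `0 ≤ ZH`.
Equivalently (via `hallGladkov_of_ixGen` / `ixGen_of_hallGladkov`) ★ for this class follows from the HALL–GLADKOV matching statement. [this work] -/
theorem Sunflower.ZH_nonneg_of_ixGen_of_intersecting (h : IXGen) (F : Sunflower α) (ℓ : Fin 5) (hℓ : ℓ = 1 ∨ ℓ = 2 ∨ ℓ = 3)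
    (hI : ∀ S T : Finset α, F.lab S = ℓ → F.lab T = ℓ → ¬ Disjoint S T) : 0 ≤ F.ZH := by
  rcases hℓ with rfl | rfl | rfl
  · exact F.ZH_nonneg_of_ixGen h hI
  · -- petal `1`: rotate once
    rw [← F.rotate_ZH]
    refine F.rotate.ZH_nonneg_of_ixGen h fun S T hS hT => hI S T ?_ ?_
    · exact (F.rotate_lab_eq_one_iff S).1 hS
    · exact (F.rotate_lab_eq_one_iff T).1 hT
  · -- petal `2`: rotate twice
    rw [← F.rotate_ZH, ← F.rotate.rotate_ZH]
    refine F.rotate.rotate.ZH_nonneg_of_ixGen h fun S T hS hT => hI S T ?_ ?_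
    · have h1 := (F.rotate.rotate_lab_eq_one_iff S).1 hS
      rw [F.lab_rotate] at h1
      revert h1; generalize F.lab S = x; revert x; decide
    · have h1 := (F.rotate.rotate_lab_eq_one_iff T).1 hT
      rw [F.lab_rotate] at h1
      revert h1; generalize F.lab T = x; revert x; decide

/-- The same with `HallGladkov` as the hypothesis. [this work] -/
theorem Sunflower.ZH_nonneg_of_hallGladkov_of_intersecting (h : HallGladkov) (F : Sunflower α) (ℓ : Fin 5) (hℓ : ℓ = 1 ∨ ℓ = 2 ∨ ℓ = 3)
    (hI : ∀ S T : Finset α, F.lab S = ℓ → F.lab T = ℓ → ¬ Disjoint S T) : 0 ≤ F.ZH :=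
  F.ZH_nonneg_of_ixGen_of_intersecting (ixGen_of_hallGladkov h) ℓ hℓ hI

end Conditional

end Summit.CriticalPhenomena.PercolationContinuityZ3.Theorems.SunflowerPartition
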